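import Summits.Ventures.PercRepro.ThetaOmegaCoreSquareMain

/-!
# (Ω) for labelled families: the relation form, the colouring reduction, and the pentagon

Dossier proofs/MINE1-theoremS.md, Addendum 83 suppl. 2–3 (mine-1, gen 44). The twice-coloured
family of `ThetaOmega.lean` generalises to a family `F` with two **labellings** `l0 l1 : Finset α → L`
into an arbitrary label type and a **relation** `R` on labels: the `A`-family collects the meets
`s ⊓ t` of distinct members with `R (l0 s) (l0 t)` and the differences `s \ t` (`s = t` allowed)
with `R (l0 s) (l1 t)`, the `C`-family the relative co-joins of distinct members with
`R (l1 s) (l1 t)` (`omegaAR`, `omegaCR`, `omegaCountR`); with `L = Bool` and `R = (· = ·)` this is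
the (Ω)-count (`omegaAR_eq_omegaA`, `omegaCR_eq_omegaC`). The question of the addendum is for which
`R` the bound `|F| ≤ omegaCountR R U F l0 l1` holds for every family with at least three members
and every pair of labellings (`OmegaRel R`).

* `card_le_omegaCountR_of_colouring` — **the colouring reduction**: if the label occurrences can be
  2-coloured so that two occurrences of the same colour always carry `R`-related labels (the
  first slot of a member and the second slot of any member included), the bound follows from (Ω)
  (`conjOmega_holds`): the (Ω)-count of the colouring sits inside the relation count;
* `omegaRel_of_cliqueCover` — hence `OmegaRel R` whenever the labels are covered by two
  `R`-cliques (the non-adjacency graph of `R` is bipartite); and `omegaRel_eq_bool` — the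
  case `R = (· = ·)` on `Bool` is (Ω) itself;
* `pentR`, `card_le_omegaCountR_pent_of_unused` — **the pentagon form**: labels in `ZMod 5`, two
  labels related iff their difference is `0`, `2` or `3` (the complement of the 5-cycle, with
  loops): every instance that leaves some label unused satisfies the bound by the colouring
  reduction (the four remaining labels split into two `R`-cliques). The bound for every instance —
  `OmegaRel α pentR` — is the first relation form whose non-adjacency graph is not bipartite (it is
  the 5-cycle, triangle-free); it is census-true (Addendum 83 suppl. 2–3) and NOT asserted here.
-/

namespace PercRepro.MSTight

open Finset

variable {α : Type*} [DecidableEq α] {L : Type*}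

section RelDefs

/-- **The `A`-family of a family with two labellings under a relation `R`**: the meets of distinct
members whose first labels are `R`-related and the differences `s \ t` (`s = t` allowed) whose
first and second labels are `R`-related. -/
def omegaAR (R : L → L → Prop) [DecidableRel R] (F : Finset (Finset α)) (l0 l1 : Finset α → L) :
    Finset (Finset α) :=
  (F.offDiag.filter fun p => R (l0 p.1) (l0 p.2)).image (fun p => p.1 ⊓ p.2) ∪
    ((F ×ˢ F).filter fun p => R (l0 p.1) (l1 p.2)).image fun p => p.1 \ p.2

/-- **The `C`-family under a relation `R`**: the relative co-joins of distinct members whose second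
labels are `R`-related. -/
def omegaCR (R : L → L → Prop) [DecidableRel R] (U : Finset α) (F : Finset (Finset α))
    (l1 : Finset α → L) : Finset (Finset α) :=
  (F.offDiag.filter fun p => R (l1 p.1) (l1 p.2)).image fun p => U \ (p.1 ⊔ p.2)

/-- **The relation count**: the two families counted separately. -/
def omegaCountR (R : L → L → Prop) [DecidableRel R] (U : Finset α) (F : Finset (Finset α))
    (l0 l1 : Finset α → L) : ℕ :=
  (omegaAR R F l0 l1).card + (omegaCR R U F l1).card

/-- **The relation form of (Ω)** for a relation `R` on labels: every family of at least three
subsets of a ground set, with any two labellings, has at least `|F|` elements in its two families. -/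
def OmegaRel (α : Type*) [DecidableEq α] (R : L → L → Prop) [DecidableRel R] : Prop :=
  ∀ (U : Finset α) (F : Finset (Finset α)) (l0 l1 : Finset α → L),
    (∀ s ∈ F, s ⊆ U) → 3 ≤ F.card → F.card ≤ omegaCountR R U F l0 l1

variable {R : L → L → Prop} [DecidableRel R] {U : Finset α} {F : Finset (Finset α)}
  {l0 l1 : Finset α → L}

/-- Membership in the relation `A`-family. -/
theorem mem_omegaAR {E : Finset α} :
    E ∈ omegaAR R F l0 l1 ↔
      (∃ s ∈ F, ∃ t ∈ F, s ≠ t ∧ R (l0 s) (l0 t) ∧ s ⊓ t = E) ∨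
        ∃ s ∈ F, ∃ t ∈ F, R (l0 s) (l1 t) ∧ s \ t = E := by
  unfold omegaAR
  simp only [mem_union, mem_image, mem_filter, mem_offDiag, mem_product, Prod.exists]
  constructor
  · rintro (⟨s, t, ⟨⟨hs, ht, hst⟩, hc⟩, h⟩ | ⟨s, t, ⟨⟨hs, ht⟩, hc⟩, h⟩)
    · exact Or.inl ⟨s, hs, t, ht, hst, hc, h⟩
    · exact Or.inr ⟨s, hs, t, ht, hc, h⟩
  · rintro (⟨s, hs, t, ht, hst, hc, h⟩ | ⟨s, hs, t, ht, hc, h⟩)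
    · exact Or.inl ⟨s, t, ⟨⟨hs, ht, hst⟩, hc⟩, h⟩
    · exact Or.inr ⟨s, t, ⟨⟨hs, ht⟩, hc⟩, h⟩

/-- Membership in the relation `C`-family. -/
theorem mem_omegaCR {E : Finset α} :
    E ∈ omegaCR R U F l1 ↔ ∃ s ∈ F, ∃ t ∈ F, s ≠ t ∧ R (l1 s) (l1 t) ∧ U \ (s ⊔ t) = E := by
  unfold omegaCR
  simp only [mem_image, mem_filter, mem_offDiag, Prod.exists]
  constructor
  · rintro ⟨s, t, ⟨⟨hs, ht, hst⟩, hc⟩, h⟩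
    exact ⟨s, hs, t, ht, hst, hc, h⟩
  · rintro ⟨s, hs, t, ht, hst, hc, h⟩
    exact ⟨s, t, ⟨⟨hs, ht, hst⟩, hc⟩, h⟩

/-- With Boolean labels and equality as the relation, the relation `A`-family is the `A`-family
of the twice-coloured family. -/
theorem omegaAR_eq_omegaA (F : Finset (Finset α)) (c0 c1 : Finset α → Bool) :
    omegaAR (· = ·) F c0 c1 = omegaA F c0 c1 := by
  ext E
  rw [mem_omegaAR, mem_omegaA]

/-- With Boolean labels and equality as the relation, the relation `C`-family is the `C`-family
of the twice-coloured family. -/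
theorem omegaCR_eq_omegaC (U : Finset α) (F : Finset (Finset α)) (c1 : Finset α → Bool) :
    omegaCR (· = ·) U F c1 = omegaC U F c1 := by
  ext E
  rw [mem_omegaCR, mem_omegaC]

/-- The relation form for equality on `Bool` is (Ω). -/
theorem omegaRel_eq_bool : OmegaRel α (fun a b : Bool => a = b) := by
  intro U F c0 c1 hF h3
  have := conjOmega_holds U F c0 c1 hF h3
  unfold omegaCountR
  rw [omegaAR_eq_omegaA, omegaCR_eq_omegaC]
  exact this

end RelDefs

section Colouring

variable {R : L → L → Prop} [DecidableRel R] {U : Finset α} {F : Finset (Finset α)}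
  {l0 l1 : Finset α → L} {φ0 φ1 : Finset α → Bool}

/-- If same-coloured occurrences carry related labels, the `A`-family of the colouring lies in the
relation `A`-family. -/
theorem omegaA_subset_omegaAR
    (h00 : ∀ s ∈ F, ∀ t ∈ F, s ≠ t → φ0 s = φ0 t → R (l0 s) (l0 t))
    (h01 : ∀ s ∈ F, ∀ t ∈ F, φ0 s = φ1 t → R (l0 s) (l1 t)) :
    omegaA F φ0 φ1 ⊆ omegaAR R F l0 l1 := by
  intro E hE
  rcases mem_omegaA.1 hE with ⟨s, hs, t, ht, hst, hc, rfl⟩ | ⟨s, hs, t, ht, hc, rfl⟩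
  · exact mem_omegaAR.2 (Or.inl ⟨s, hs, t, ht, hst, h00 s hs t ht hst hc, rfl⟩)
  · exact mem_omegaAR.2 (Or.inr ⟨s, hs, t, ht, h01 s hs t ht hc, rfl⟩)

/-- If same-coloured second occurrences carry related labels, the `C`-family of the colouring lies
in the relation `C`-family. -/
theorem omegaC_subset_omegaCR
    (h11 : ∀ s ∈ F, ∀ t ∈ F, s ≠ t → φ1 s = φ1 t → R (l1 s) (l1 t)) :
    omegaC U F φ1 ⊆ omegaCR R U F l1 := by
  intro E hE
  obtain ⟨s, hs, t, ht, hst, hc, rfl⟩ := mem_omegaC.1 hE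
  exact mem_omegaCR.2 ⟨s, hs, t, ht, hst, h11 s hs t ht hst hc, rfl⟩

/-- **The colouring reduction**: a 2-colouring of the label occurrences (`φ0` for the first
labels, `φ1` for the second) under which equal colours always carry `R`-related labels gives the
relation bound from (Ω). -/
theorem card_le_omegaCountR_of_colouring (hF : ∀ s ∈ F, s ⊆ U) (h3 : 3 ≤ F.card)
    (h00 : ∀ s ∈ F, ∀ t ∈ F, s ≠ t → φ0 s = φ0 t → R (l0 s) (l0 t))
    (h01 : ∀ s ∈ F, ∀ t ∈ F, φ0 s = φ1 t → R (l0 s) (l1 t))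
    (h11 : ∀ s ∈ F, ∀ t ∈ F, s ≠ t → φ1 s = φ1 t → R (l1 s) (l1 t)) :
    F.card ≤ omegaCountR R U F l0 l1 := by
  have hΩ := conjOmega_holds U F φ0 φ1 hF h3
  unfold omegaCount at hΩ
  unfold omegaCountR
  have hA := card_le_card (omegaA_subset_omegaAR (R := R) (l0 := l0) (l1 := l1) h00 h01)
  have hC := card_le_card (omegaC_subset_omegaCR (R := R) (U := U) (l1 := l1) h11)
  omega

/-- **Two `R`-cliques covering the labels give the relation form**: if `χ : L → Bool` has
`χ x = χ y → R x y` (the non-adjacency graph of `R` is bipartite), then `OmegaRel α R`. -/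
theorem omegaRel_of_cliqueCover (χ : L → Bool) (hχ : ∀ x y, χ x = χ y → R x y) :
    OmegaRel α R := by
  intro U F l0 l1 hF h3
  exact card_le_omegaCountR_of_colouring (φ0 := fun s => χ (l0 s)) (φ1 := fun s => χ (l1 s)) hF h3
    (fun s _ t _ _ h => hχ _ _ h) (fun s _ t _ h => hχ _ _ h) (fun s _ t _ _ h => hχ _ _ h)

end Colouring

section Pentagon

/-- **The pentagon relation** on `ZMod 5`: two labels are related iff their difference is `0`,
`2` or `3` — every pair except the cyclically adjacent ones (the complement of the 5-cycle, with
loops). -/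
abbrev pentR (x y : ZMod 5) : Prop := x - y = 0 ∨ x - y = 2 ∨ x - y = 3

/-- The pentagon relation is symmetric. -/
theorem pentR_symm {x y : ZMod 5} (h : pentR x y) : pentR y x := by
  unfold pentR at *
  rcases h with h | h | h
  · left; rw [← neg_sub, h, neg_zero]
  · right; right; rw [← neg_sub, h]; decide
  · right; left; rw [← neg_sub, h]; decide

/-- Two labels with the same parity class around an unused label `v` — both in `{v + 1, v + 3}` or
both in `{v + 2, v + 4}` (the value `v` itself excluded) — are pentagon-related. -/
theorem pentR_of_same_class (v x y : ZMod 5) (hx : x ≠ v) (hy : y ≠ v)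
    (h : decide (x - v = 1 ∨ x - v = 3) = decide (y - v = 1 ∨ y - v = 3)) : pentR x y := by
  unfold pentR
  revert v x y
  decide

/-- **The pentagon form holds on every instance that leaves a label unused**: the four remaining
labels split into the two cliques `{v + 1, v + 3}` and `{v + 2, v + 4}`, and the colouring
reduction applies. -/
theorem card_le_omegaCountR_pent_of_unused {U : Finset α} {F : Finset (Finset α)}
    {l0 l1 : Finset α → ZMod 5} (hF : ∀ s ∈ F, s ⊆ U) (h3 : 3 ≤ F.card) (v : ZMod 5)
    (hv : ∀ s ∈ F, l0 s ≠ v ∧ l1 s ≠ v) :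
    F.card ≤ omegaCountR pentR U F l0 l1 :=
  card_le_omegaCountR_of_colouring
    (φ0 := fun s => decide (l0 s - v = 1 ∨ l0 s - v = 3))
    (φ1 := fun s => decide (l1 s - v = 1 ∨ l1 s - v = 3)) hF h3
    (fun s hs t ht _ h => pentR_of_same_class v _ _ (hv s hs).1 (hv t ht).1 h)
    (fun s hs t ht h => pentR_of_same_class v _ _ (hv s hs).1 (hv t ht).2 h)
    (fun s hs t ht _ h => pentR_of_same_class v _ _ (hv s hs).2 (hv t ht).2 h)

/-- **Conjecture (PENT)**: the relation form of (Ω) for the pentagon relation on every instance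
(the instances using all five labels are the ones the colouring reduction does not reach) —
census-true: exhaustive on 3 points to `|F| = 6` and on 4 points to `|F| = 5`, annealing to 8 points
(Addendum 83 suppl. 2–4). A candidate proposition, NOT asserted. -/
def OmegaPentagon (α : Type*) [DecidableEq α] : Prop := OmegaRel α pentR

end Pentagon

end PercRepro.MSTight
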